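import Summits.BirchSwinnertonDyer.BirchSwinnertonDyer.Theorems.CongruentShaFreeCutBDPUpToRigidityUnconditional
import Summits.BirchSwinnertonDyer.BirchSwinnertonDyer.Theorems.MordellShaFreeCutThreeAdicBDPTriple
import Literature.NumberTheory.EllipticCurves.CastellaGrossiLeeSkinner2022.IMC2DivisibilityAndBDPValueFrame
import Literature.NumberTheory.QuadraticFields.KroneckerSplitting
import HarnessLib

set_option linter.dupNamespace false -- `Summit.BirchSwinnertonDyer.BirchSwinnertonDyer.Theorems.…` (summit = sub)
set_option autoImplicit false

/-!
# Route `MordellShaFreeCut` (rung S2b) — the VALUE HALF of the BDP road for the EXACT frame as ONE NAMED `Prop`: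
# the generalised `p`-adic Waldspurger / BDP formula at the trivial character, value up to a unit of `R₀`, at a
# prime that MAY DIVIDE the level (SERVICE TWIN of `CongruentShaFreeCutBDPWaldspurgerFormula.lean`, exact frame)

Cell `bsd-cn100`, prover seat `bsd-cn100-transfer` (g11); D0074 §6 addendum 9, transfer row «OPTIONAL by CLAIM: the
S2b twin of (e2)» (CLAIM on STATUS 2026-08-27T03:2xZ; s2b-c3 does not need it for v6br). Supports, does not close,
stmt-BirchSwinnertonDyer-19159. ONE DEFINITION (`@[conjecture]`, nothing asserted) + two theorems; imports no
`Theses` module directly. PARTITION: none — RANK axis. HONEST FRAMING: in print only for `p ∤ N`, `p ≠ 2`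
(BDP 2013 Thm. 5.13 / CGLS 2022 Thm. 5.1.3 = tree named fact `thm513_exists_isBDPLFunction_valueAtOne`); OPEN at an
additive prime (the `j = 0` curves at `3`, `E_n` at `2`).

* `BDPWaldspurgerFormula p` — for every modular `E/ℚ` (no `j`-restriction), Heegner field `K` with `p` split,
  datum `(κ, γ)`, Heegner point `P`, and EVERY exact frame `IsBDPLFunction ι' v κ γ f_E Ω_K Ω_p 𝓛` (`Ω_K ≠ 0`,
  `Ω_p ∈ R₀ˣ`): `𝓛(𝟙) = u · c⁻² (1 − a_p p⁻¹ + [p ∤ N] p⁻¹)² (log_ω P)²` with `u ∈ R₀ˣ`.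
* `threeAdicBDPValueAtOne_of_waldspurger` — the registered-shape (LB-bdp) `ThreeAdicBDPValueAtOne` (line v6bq /
  v6br of 19159) is its specialisation to `p = 3`, `j = 0`.
* `valueAtOne_of_thm513_of_isBDPLFunction` — at a GOOD ODD split prime the printed ∃-frame statement + the exact
  LEMMA R (`constantCoeff_eq_of_isBDPLFunction`: two exact frames of the same `(ι', v, κ, γ, f_E)` have the SAME
  constant coefficient) give the value of EVERY exact frame with the SAME unit `u` — the shape
  `BDPWaldspurgerFormula p` names at every prime, UP TO THE `a_p` VOCABULARY SEAM recorded below (R-IXT-1).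
  Independent of the ♯ version `BDPWaldspurgerFormulaUpTo` (neither implies the other in general: the exact
  statement is vacuous where no exact frame exists). It binds the declaration of record
  `thm513_exists_isBDPLFunction_valueAtOne`, which carries the cross-cell scope flag `CGLS22-Thm513-disc`
  (STRONGER-THAN-PRINT on (disc): CGLS §2's standing hypothesis «`D_K` odd and `D_K ≠ −3`» = BDP 2013 Assumption
  5.12 (3) is not a binder there), so as typed it inherits that flag; kept (kernel-true, conditional, 0 callers).
* `valueAtOne_of_thm513disc_of_isBDPLFunction` (R-CITED-r09-1, appended 2026-08-27) — the SAME theorem fed by the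
  PRINT-FAITHFUL twin `thm513_exists_isBDPLFunction_valueAtOne_disc`, with the two (disc) binders
  `(hodd : Odd (NumberField.discr K)) (hd3 : NumberField.discr K ≠ -3)` after `hHN`; same proof, same conclusion —
  the consumer-facing form. On the `j = 0` frames of this route `hd3` is FREE: `3` splits in their Heegner fields
  (the `(spl)` clause at `p = 3` of `MordellShaFreeCutThreeAdicBDPTriple`, or the Heegner hypothesis at a level
  divisible by `3`), and `3` ramifies in `ℚ(√−3)` (`discr_ne_neg_three_of_three_split`,
  `discr_ne_neg_three_of_heegner_of_three_dvd`, from the tree's decomposition law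
  `Quadratic.ncard_primesOver_eq_two_iff_jacobiSym`); `hodd` is NOT derivable from the Heegner hypothesis at an odd
  level and stays a binder (the existence-half files of this route already carry `Odd (NumberField.discr K)`).
  Cost form: `valueAtOne_of_thm513disc_of_isBDPLFunction_of_three_dvd` (`h3N : 3 ∣ N`, `hodd`; no `hd3`).

THE `a_p` VOCABULARY SEAM (R-IXT-1; referee Part IX-T ADJ-2, reads R1G22-5 / R2G48-5). The theorems of this file
display `a_p` as `W.frobeniusTrace p` (the print-side transcription of CGLS Thm. 5.1.3 on a globally minimal `W`),
whereas the named Prop `BDPWaldspurgerFormula p` above writes `E.LFunction p` and the guard `[p ∤ N]·p⁻¹`. At a good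
prime the two agree by the tree BRIDGE `Literature.NumberTheory.EllipticCurves.LFunction_apply_prime_eq_frobeniusTrace`
(file `LFunctionPrimeCoeff.lean`; hypothesis `W.HasGoodReductionAtPrime p`) composed with the GLUE
`Literature.NumberTheory.EllipticCurves.hasGoodReductionAtPrime_of_not_dvd_conductorNorm` (file
`HidaFamilyMembersProofs.lean`; `¬ p ∣ N_E → good reduction at p`, with `E.conductorNorm ℤ = N` on the Prop's side)
and the guard evaluation `[p ∤ N] = 1` under `hpN`. NO theorem of this file crosses the two vocabularies: the one-line
reading theorem (FromPrint display → an instance of the Prop's display at good odd `p ∤ N`) is owed ONLY together with a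
consumer that does (R-IXT-2), and is deliberately not here.

References: [BertoliniDarmonPrasanna2013] Thm. 5.13 with Assumption 5.12 (3); [CastellaGrossiLeeSkinner2022] Thm. 5.1.3
with §2 (Heeg)/(spl)/(disc); [Castella2018] Thm. 3.1; [SilvermanAEC2009] Ex. 8.19(a) (the bridge); [Silverman1994]
IV.10.2(a) (the glue). Shapes only; nothing asserted.
-/

noncomputable section

open scoped Classical

open PowerSeries WeierstrassCurve NumberField IsDedekindDomain Field Literature.NumberTheory.EllipticCurves
  Literature.NumberTheory.EllipticCurves.ModularForms Literature.NumberTheory.QuadraticFields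
  Literature.NumberTheory.EllipticCurves.Castella2018
  Literature.NumberTheory.EllipticCurves.CastellaGrossiLeeSkinner2022
open Literature.NumberTheory.GaloisRepresentations
open Summit.BirchSwinnertonDyer.BirchSwinnertonDyer.Theorems.MordellShaFreeCutThreeAdicBDPTriple
  (ThreeAdicBDPValueAtOne)
open Summit.BirchSwinnertonDyer.BirchSwinnertonDyer.Theorems.CongruentShaFreeCutBDPUpToRigidity
  (constantCoeff_eq_of_isBDPLFunction)

namespace Summit.BirchSwinnertonDyer.BirchSwinnertonDyer.Theorems.MordellShaFreeCutBDPWaldspurgerFormula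

/-- **The generalised `p`-adic Waldspurger / BDP formula at the trivial character for the EXACT frame, value up
to a unit of `R₀`, at a prime that MAY DIVIDE the level** (the VALUE HALF of the S2b-type BDP road as one named
`Prop`). For every modular elliptic curve `E/ℚ` of conductor `N` (datum `Dt`, Manin constant `c = Dt.c`, newform
`f_E = Dt.f`), every imaginary quadratic `K` with the Heegner hypothesis for `N` in which `p = v v̄` splits,
`ι'` and `e : K → ℚ_p` inducing `v`, anticyclotomic datum `κ` with topological generator `γ`, the Heegner point `P`
(`w(P) = heegnerPointComplex Dt H`), and EVERY exact frame `IsBDPLFunction ι' v κ γ f_E Ω_K Ω_p 𝓛` with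
`Ω_K ≠ 0`, `Ω_p ∈ R₀ˣ`: `𝓛(𝟙) = u · c⁻² · (1 − a_p·p⁻¹ + [p ∤ N]·p⁻¹)² · (log_ω P)²` for some `u ∈ R₀ˣ`
(`a_p = E.LFunction p`). IN PRINT for `p ∤ N`, `p ≠ 2` — OPEN at additive `p`. A STATEMENT ONLY; nothing asserted.
[cite: BertoliniDarmonPrasanna2013, Thm. 5.13 (shape; p ∤ N there; nothing asserted)]
[cite: CastellaGrossiLeeSkinner2022, Thm. 5.1.3 (shape; p ∤ 2N there; nothing asserted)] -/
@[conjecture] def BDPWaldspurgerFormula (p : ℕ) [Fact p.Prime] : Prop :=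
  ∀ (E : WeierstrassCurve ℚ) [E.IsElliptic] [E.IsGloballyMinimal]
    (ι' : PadicAlgCl p ≃+* ℂ) (K : Type) [Field K] [NumberField K] (N : ℕ) [NeZero N]
    (Dt : ModularParametrizationData E N)
    (H : HeegnerDatum N (NumberField.discr K)) (w : InfinitePlace K) (e : K →+* ℚ_[p])
    (v : HeightOneSpectrum (𝓞 K)) (κ : ZpExtension K p) (γ : absoluteGaloisGroup K)
    [Fact (κ.IsTopGenerator γ)] (P : (E.baseChange K).toAffine.Point),
  E.conductorNorm ℤ = N → IsImaginaryQuadratic K →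
  SatisfiesHeegnerHypothesis N K → ((Ideal.span {(p : ℤ)}).primesOver (𝓞 K)).ncard = 2 →
  ((p : ℕ) : 𝓞 K) ∈ v.asIdeal →
  (∀ (w' : InfinitePlace K) (k : 𝓞 K), k ∈ v.asIdeal ↔ ‖ι'.symm (w'.embedding (k : K))‖ < 1) →
  κ.IsAnticyclotomic →
  WeierstrassCurve.Affine.Point.map w.embedding.toRatAlgHom P = heegnerPointComplex Dt H →
  (∀ k : 𝓞 K, k ∈ v.asIdeal ↔ ‖e (k : K)‖ < 1) →
  ∀ (ΩK : ℂ) (Ωp : (unrIntegers p)ˣ) (L : UnrSeries p),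
    ΩK ≠ 0 → IsBDPLFunction ι' v κ γ Dt.f ΩK ((Ωp : unrIntegers p) : ℂ_[p]) L →
    ∃ u : (unrIntegers p)ˣ, L.HasValueAt 0
      (((u : unrIntegers p) : ℂ_[p]) *
        algebraMap ℚ_[p] ℂ_[p] (((Dt.c : ℚ_[p])⁻¹) ^ 2 *
          (1 - (E.LFunction p : ℚ_[p]) * (p : ℚ_[p])⁻¹ +
            (if p ∣ N then 0 else (p : ℚ_[p])⁻¹)) ^ 2 *
          (padicLogOmega E p e P) ^ 2))

/-- **Reading: (LB-bdp) for the `j = 0` curves at `3` is the specialisation of `BDPWaldspurgerFormula 3`** (the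
registered-shape `ThreeAdicBDPValueAtOne`, token-for-token; the `j = 0` binder is simply not used). [folklore] -/
theorem threeAdicBDPValueAtOne_of_waldspurger (h : BDPWaldspurgerFormula 3) : ThreeAdicBDPValueAtOne := by
  intro W _ _ _ ι' K _ _ N _ Dt H w e v κ γ _ P hN hK hHN hsplit hv3 hι' hκ hP he ΩK Ωp L hΩK hL
  have h3 : ((Ideal.span {((3 : ℕ) : ℤ)}).primesOver (𝓞 K)).ncard = 2 := by simpa using hsplit
  obtain ⟨u, hval⟩ := h W ι' K N Dt H w e v κ γ P hN hK hHN h3 hv3 hι' hκ hP he ΩK Ωp L hΩK hL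
  refine ⟨u, ?_⟩
  simpa using hval

/-- **At a good odd split prime, the printed ∃-frame BDP formula gives the value at 𝟙 of EVERY exact frame, with
the SAME unit** — PRINT (`thm513_exists_isBDPLFunction_valueAtOne`, CGLS 2022 Thm. 5.1.3 / BDP 2013 Thm. 5.13) +
the exact LEMMA R (`constantCoeff_eq_of_isBDPLFunction`: two exact frames of the same `(ι', v, κ, γ, f_E)` have equal
constant coefficients). Conditional on the named fact; nothing asserted.
[cite: CastellaGrossiLeeSkinner2022, Thm. 5.1.3 (shape; nothing asserted)] [cite: Castella2018, Thm. 3.1] -/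
theorem valueAtOne_of_thm513_of_isBDPLFunction (h513 : thm513_exists_isBDPLFunction_valueAtOne)
    {p : ℕ} [Fact p.Prime] (ι' : PadicAlgCl p ≃+* ℂ) (W : WeierstrassCurve ℚ) [W.IsElliptic]
    [W.IsGloballyMinimal] (K : Type) [Field K] [NumberField K] (v : HeightOneSpectrum (𝓞 K))
    (κ : ZpExtension K p) (γ : absoluteGaloisGroup K) {N : ℕ} [NeZero N]
    (Dt : ModularParametrizationData W N) (H : HeegnerDatum N (NumberField.discr K))
    (w : InfinitePlace K) (e : K →+* ℚ_[p]) (P : (W.baseChange K).toAffine.Point)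
    (hp2 : p ≠ 2) (hpN : ¬ p ∣ N) (hK : IsImaginaryQuadratic K)
    (hsplit : ((Ideal.span {(p : ℤ)}).primesOver (𝓞 K)).ncard = 2) (hv : ((p : ℕ) : 𝓞 K) ∈ v.asIdeal)
    (hι' : ∀ (w' : InfinitePlace K) (k : 𝓞 K), k ∈ v.asIdeal ↔ ‖ι'.symm (w'.embedding (k : K))‖ < 1)
    (hHN : SatisfiesHeegnerHypothesis N K) (hκ : κ.IsAnticyclotomic) (hγ : κ.IsTopGenerator γ)
    (hP : WeierstrassCurve.Affine.Point.map w.embedding.toRatAlgHom P = heegnerPointComplex Dt H)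
    (he : ∀ k : 𝓞 K, k ∈ v.asIdeal ↔ ‖e (k : K)‖ < 1)
    {ΩK' : ℂ} {Ωp' : ℂ_[p]} {L' : UnrSeries p} (hΩK' : ΩK' ≠ 0) (hΩp' : Ωp' ≠ 0)
    (hL' : IsBDPLFunction ι' v κ γ Dt.f ΩK' Ωp' L') :
    ∃ u : (unrIntegers p)ˣ, L'.HasValueAt 0
      (((u : unrIntegers p) : ℂ_[p]) * algebraMap ℚ_[p] ℂ_[p] (((Dt.c : ℚ_[p])⁻¹) ^ 2 *
          (1 - (W.frobeniusTrace p : ℚ_[p]) * (p : ℚ_[p])⁻¹ + (p : ℚ_[p])⁻¹) ^ 2 *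
          (padicLogOmega W p e P) ^ 2)) := by
  obtain ⟨ΩK, Ωp, L, hΩK, hL, u₀, hval⟩ :=
    h513 ι' W K v κ γ Dt H w e P hp2 hpN hK hsplit hv hι' hHN hκ hγ hP he
  have hΩp : ((Ωp : unrIntegers p) : ℂ_[p]) ≠ 0 := fun h ↦ (Units.ne_zero Ωp) (Subtype.ext h)
  -- exact LEMMA R: `[T⁰]L' = [T⁰]L`
  have hR := constantCoeff_eq_of_isBDPLFunction hK hκ hγ hΩK hΩK' hΩp hΩp' hL hL'
  have h0 := UnrSeries.eq_constantCoeff_of_hasValueAt_zero hval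
  refine ⟨u₀, ?_⟩
  have hval' := L'.hasValueAt_zero
  rw [hR, ← h0] at hval'
  exact hval'

/-! ## R-CITED-r09-1 (2026-08-27): the print-faithful twin WITH CGLS §2's (disc), and its cost form on the
## levels divisible by `3` (all the `j = 0` frames of this route) -/

/-- **At a good odd split prime, the printed ∃-frame BDP formula — in its PRINT-FAITHFUL form, i.e. under CGLS §2's
standing hypothesis (disc) «`D_K` odd and `D_K ≠ −3`» (= BDP 2013 Assumption 5.12 (3)) — gives the value at 𝟙 of
EVERY exact frame, with the SAME unit.** The same statement and proof as `valueAtOne_of_thm513_of_isBDPLFunction`,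
fed by the corrected named fact `thm513_exists_isBDPLFunction_valueAtOne_disc` with the two (disc) binders `hodd`,
`hd3` inserted after `hHN` (repair R-CITED-r09-1 of the cross-cell audit D-AUDIT-r09-ADDENDUM-4; kernel bytes of
that sheet's K9). PRINT + the exact LEMMA R (`constantCoeff_eq_of_isBDPLFunction`). Conditional on the named fact;
nothing asserted.
[cite: CastellaGrossiLeeSkinner2022, Thm. 5.1.3 with the standing hypotheses of §2 ((Heeg), (spl), (disc)) (shape; nothing asserted)]
[cite: BertoliniDarmonPrasanna2013, Thm. 5.13 with Assumption 5.12 (3)] [cite: Castella2018, Thm. 3.1] -/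
theorem valueAtOne_of_thm513disc_of_isBDPLFunction (h513 : thm513_exists_isBDPLFunction_valueAtOne_disc)
    {p : ℕ} [Fact p.Prime] (ι' : PadicAlgCl p ≃+* ℂ) (W : WeierstrassCurve ℚ) [W.IsElliptic]
    [W.IsGloballyMinimal] (K : Type) [Field K] [NumberField K] (v : HeightOneSpectrum (𝓞 K))
    (κ : ZpExtension K p) (γ : absoluteGaloisGroup K) {N : ℕ} [NeZero N]
    (Dt : ModularParametrizationData W N) (H : HeegnerDatum N (NumberField.discr K))
    (w : InfinitePlace K) (e : K →+* ℚ_[p]) (P : (W.baseChange K).toAffine.Point)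
    (hp2 : p ≠ 2) (hpN : ¬ p ∣ N) (hK : IsImaginaryQuadratic K)
    (hsplit : ((Ideal.span {(p : ℤ)}).primesOver (𝓞 K)).ncard = 2) (hv : ((p : ℕ) : 𝓞 K) ∈ v.asIdeal)
    (hι' : ∀ (w' : InfinitePlace K) (k : 𝓞 K), k ∈ v.asIdeal ↔ ‖ι'.symm (w'.embedding (k : K))‖ < 1)
    (hHN : SatisfiesHeegnerHypothesis N K)
    (hodd : Odd (NumberField.discr K)) (hd3 : NumberField.discr K ≠ -3)
    (hκ : κ.IsAnticyclotomic) (hγ : κ.IsTopGenerator γ)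
    (hP : WeierstrassCurve.Affine.Point.map w.embedding.toRatAlgHom P = heegnerPointComplex Dt H)
    (he : ∀ k : 𝓞 K, k ∈ v.asIdeal ↔ ‖e (k : K)‖ < 1)
    {ΩK' : ℂ} {Ωp' : ℂ_[p]} {L' : UnrSeries p} (hΩK' : ΩK' ≠ 0) (hΩp' : Ωp' ≠ 0)
    (hL' : IsBDPLFunction ι' v κ γ Dt.f ΩK' Ωp' L') :
    ∃ u : (unrIntegers p)ˣ, L'.HasValueAt 0
      (((u : unrIntegers p) : ℂ_[p]) * algebraMap ℚ_[p] ℂ_[p] (((Dt.c : ℚ_[p])⁻¹) ^ 2 *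
          (1 - (W.frobeniusTrace p : ℚ_[p]) * (p : ℚ_[p])⁻¹ + (p : ℚ_[p])⁻¹) ^ 2 *
          (padicLogOmega W p e P) ^ 2)) := by
  obtain ⟨ΩK, Ωp, L, hΩK, hL, u₀, hval⟩ :=
    h513 ι' W K v κ γ Dt H w e P hp2 hpN hK hsplit hv hι' hHN hodd hd3 hκ hγ hP he
  have hΩp : ((Ωp : unrIntegers p) : ℂ_[p]) ≠ 0 := fun h ↦ (Units.ne_zero Ωp) (Subtype.ext h)
  -- exact LEMMA R: `[T⁰]L' = [T⁰]L`
  have hR := constantCoeff_eq_of_isBDPLFunction hK hκ hγ hΩK hΩK' hΩp hΩp' hL hL'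
  have h0 := UnrSeries.eq_constantCoeff_of_hasValueAt_zero hval
  refine ⟨u₀, ?_⟩
  have hval' := L'.hasValueAt_zero
  rw [hR, ← h0] at hval'
  exact hval'

/-- **`3` split in a quadratic field forces `d_K ≠ −3`** (in `ℚ(√−3)` the prime `3` ramifies): by the decomposition
law at an odd prime (`Quadratic.ncard_primesOver_eq_two_iff_jacobiSym`), `3` splits iff the Jacobi symbol
`(d_K / 3) = 1`, while `(−3 / 3) = (0 / 3) = 0`. The `(spl)`-at-`3` clause of every `j = 0` frame of this route
(`MordellShaFreeCutThreeAdicBDPTriple`) therefore supplies the second (disc) binder. Elementary; the cross-cell sheet's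
K4/K8. [folklore] -/
theorem discr_ne_neg_three_of_three_split {K : Type} [Field K] [NumberField K] (hK : IsImaginaryQuadratic K)
    (h3 : ((Ideal.span {(3 : ℤ)}).primesOver (𝓞 K)).ncard = 2) : NumberField.discr K ≠ -3 := by
  intro hd
  have h3' : ((Ideal.span {((3 : ℕ) : ℤ)}).primesOver (𝓞 K)).ncard = 2 := by simpa using h3
  have hj := (Quadratic.ncard_primesOver_eq_two_iff_jacobiSym hK.1 Nat.prime_three (by norm_num)).mp h3'
  rw [hd, jacobiSym.mod_left] at hj
  norm_num [jacobiSym.zero_left] at hj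

/-- **`d_K ≠ −3` is FREE on every level divisible by `3` under the Heegner hypothesis** (then `3` must split in `K`;
apply `discr_ne_neg_three_of_three_split`). This is the case of every `j = 0` curve over `ℚ` (additive, hence bad,
reduction at `3`: `3 ∣ N`). The other (disc) binder, `Odd (discr K)`, does NOT follow from the Heegner hypothesis at
an odd level (e.g. `K = ℚ(√−2)` for `N = 27`) and is kept. [folklore] -/
theorem discr_ne_neg_three_of_heegner_of_three_dvd {K : Type} [Field K] [NumberField K]
    (hK : IsImaginaryQuadratic K) {N : ℕ} (h3N : 3 ∣ N) (hHN : SatisfiesHeegnerHypothesis N K) :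
    NumberField.discr K ≠ -3 :=
  discr_ne_neg_three_of_three_split hK (by simpa using hHN 3 Nat.prime_three h3N)

/-- **Cost form on the levels divisible by `3`.** At a good odd split prime `p` of a curve whose level `N` is
divisible by `3` (every `j = 0` curve), the print-faithful BDP formula gives the value at 𝟙 of EVERY exact frame with
the same unit, with the single (disc) binder `hodd : Odd (discr K)`: `(h3N : 3 ∣ N)` and the Heegner hypothesis
supply `discr K ≠ −3` (`discr_ne_neg_three_of_heegner_of_three_dvd`). Conditional on the named fact; nothing
asserted. [cite: CastellaGrossiLeeSkinner2022, Thm. 5.1.3 with the standing hypotheses of §2 (shape; nothing asserted)]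
[cite: BertoliniDarmonPrasanna2013, Thm. 5.13 with Assumption 5.12 (3)] -/
theorem valueAtOne_of_thm513disc_of_isBDPLFunction_of_three_dvd
    (h513 : thm513_exists_isBDPLFunction_valueAtOne_disc)
    {p : ℕ} [Fact p.Prime] (ι' : PadicAlgCl p ≃+* ℂ) (W : WeierstrassCurve ℚ) [W.IsElliptic]
    [W.IsGloballyMinimal] (K : Type) [Field K] [NumberField K] (v : HeightOneSpectrum (𝓞 K))
    (κ : ZpExtension K p) (γ : absoluteGaloisGroup K) {N : ℕ} [NeZero N]
    (Dt : ModularParametrizationData W N) (H : HeegnerDatum N (NumberField.discr K))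
    (w : InfinitePlace K) (e : K →+* ℚ_[p]) (P : (W.baseChange K).toAffine.Point)
    (hp2 : p ≠ 2) (hpN : ¬ p ∣ N) (h3N : 3 ∣ N) (hK : IsImaginaryQuadratic K)
    (hsplit : ((Ideal.span {(p : ℤ)}).primesOver (𝓞 K)).ncard = 2) (hv : ((p : ℕ) : 𝓞 K) ∈ v.asIdeal)
    (hι' : ∀ (w' : InfinitePlace K) (k : 𝓞 K), k ∈ v.asIdeal ↔ ‖ι'.symm (w'.embedding (k : K))‖ < 1)
    (hHN : SatisfiesHeegnerHypothesis N K) (hodd : Odd (NumberField.discr K))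
    (hκ : κ.IsAnticyclotomic) (hγ : κ.IsTopGenerator γ)
    (hP : WeierstrassCurve.Affine.Point.map w.embedding.toRatAlgHom P = heegnerPointComplex Dt H)
    (he : ∀ k : 𝓞 K, k ∈ v.asIdeal ↔ ‖e (k : K)‖ < 1)
    {ΩK' : ℂ} {Ωp' : ℂ_[p]} {L' : UnrSeries p} (hΩK' : ΩK' ≠ 0) (hΩp' : Ωp' ≠ 0)
    (hL' : IsBDPLFunction ι' v κ γ Dt.f ΩK' Ωp' L') :
    ∃ u : (unrIntegers p)ˣ, L'.HasValueAt 0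
      (((u : unrIntegers p) : ℂ_[p]) * algebraMap ℚ_[p] ℂ_[p] (((Dt.c : ℚ_[p])⁻¹) ^ 2 *
          (1 - (W.frobeniusTrace p : ℚ_[p]) * (p : ℚ_[p])⁻¹ + (p : ℚ_[p])⁻¹) ^ 2 *
          (padicLogOmega W p e P) ^ 2)) :=
  valueAtOne_of_thm513disc_of_isBDPLFunction h513 ι' W K v κ γ Dt H w e P hp2 hpN hK hsplit hv hι' hHN hodd
    (discr_ne_neg_three_of_heegner_of_three_dvd hK h3N hHN) hκ hγ hP he hΩK' hΩp' hL'

end Summit.BirchSwinnertonDyer.BirchSwinnertonDyer.Theorems.MordellShaFreeCutBDPWaldspurgerFormula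

end
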